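import Mathlib

/-!
# The closing algebra of an `H¹`-Schauder existence scheme for a self-similar profile

Cell pub-nsjs (papers/NavierStokesRegularity/ns-jia-sverak), typer gen 11. Companion of `ProfileCAP.lean`, which
records the Newton–Kantorovich interface `CAPData` (closing inequality `4 M K (K ε) ≤ 1`). The cell's LEMMA-D.md
shows that, for the Guillod–Šverák candidate, that inequality would need a defect `ε` two to three decades below
what the present approximation class can deliver, and that the scheme with a live threshold is the EXISTENCE-ONLY
`H¹`-Schauder scheme: split the linearisation `𝓛 = 𝓛₁ + 𝓛₂` into a coercive part (`(𝓛₁h,h) ≥ (¼ − η₁)‖h‖² + ‖∇h‖²`,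
the `¼` being the essential-spectrum edge of Jia–Šverák 2015) and a compact part supported on the negative set of
the strain, handled by a finite-rank approximate inverse; the fixed-point map then satisfies an a-priori bound
`a‖U*‖² + b‖∇U*‖² ≤ (ε + M₃‖U‖²)‖U*‖` on a ball, with `a = ¼ − η₁ − M₂ > 0`, `b = 1 − M₁ > 0`, `M₃` the nonlinear
constant. Such a scheme is in print for a DIFFERENT profile in T. Y. Hou, Y. Wang, Z. Yang, arXiv:2509.25116 (2025,
Prop. "Exact self-similar profile", TeX L1814–2058) — a manuscript UNDER ADJUDICATION by this cell, so nothing of it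
is cited as a fact here; the present file records only the elementary real-number algebra of its closing step
(re-derived in LEMMA-D.md §5 and pub-nsjs-profile/HWY-PROFILE-AUDIT.md step 7), which is folklore:

* the closing condition `4 M₃ ε < a²`, the smaller root `x₀ = 2ε / (a + √(a² − 4M₃ε))` of `M₃ x² − a x + ε = 0`,
  the identity `ε + M₃ x₀² = a x₀` (`root_identity`), and
* the SELF-MAP lemma (`selfMap`): if `a s² + b t² ≤ (ε + M₃ x₀²) s` with `s, t ≥ 0`, then `s ≤ x₀` and
  `b t² ≤ a x₀² / 4` (so `t ≤ √(a/b) · x₀ / 2`).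

Everything analytic (the coercivity identity, the compactness, the finite-rank data with its tolerances, Schauder's
theorem, the passage `R → ∞`, and regularity/decay of the weak solution) is NOT here: it is the content of the open
nodes CAP-1f / CAP-1g / L-E of the cell's LEMMAS.md. No number is asserted for the Guillod–Šverák profile.
-/

namespace Literature.Analysis.FluidPDE.GuillodSverak2023

/-- The four constants of the closing step of an `H¹`-Schauder existence scheme and the closing condition
`4 M₃ ε < a²` (`a` = coercivity constant left after the tolerances, `b` = gradient coercivity, `ε` = defect of the
candidate, `M₃` = nonlinear constant). [folklore] (LEMMA-D.md §5) -/
structure SchauderClosingData where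
  a : ℝ
  b : ℝ
  ε : ℝ
  M₃ : ℝ
  ha : 0 < a
  hb : 0 < b
  hε : 0 ≤ ε
  hM₃ : 0 ≤ M₃
  /-- The closing condition. -/
  closing : 4 * M₃ * ε < a ^ 2

namespace SchauderClosingData

variable (D : SchauderClosingData)

/-- The discriminant `M₄ = a² − 4 M₃ ε`. [folklore] -/
def M₄ : ℝ := D.a ^ 2 - 4 * D.M₃ * D.ε

/-- `M₄ > 0` under the closing condition. [folklore] -/
theorem M₄_pos : 0 < D.M₄ := by
  unfold M₄; linarith [D.closing]

/-- The smaller root `x₀ = 2ε / (a + √M₄)` of `M₃ x² − a x + ε = 0` (the radius of the self-mapped ball). [folklore] -/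
noncomputable def x₀ : ℝ := 2 * D.ε / (D.a + Real.sqrt D.M₄)

/-- `√M₄ > 0`. [folklore] -/
theorem sqrt_M₄_pos : 0 < Real.sqrt D.M₄ := Real.sqrt_pos.mpr D.M₄_pos

/-- `(√M₄)² = a² − 4 M₃ ε`. [folklore] -/
theorem sq_sqrt_M₄ : Real.sqrt D.M₄ ^ 2 = D.a ^ 2 - 4 * D.M₃ * D.ε := by
  rw [Real.sq_sqrt D.M₄_pos.le]; rfl

/-- `x₀ ≥ 0`. [folklore] -/
theorem x₀_nonneg : 0 ≤ D.x₀ := by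
  unfold x₀
  exact div_nonneg (by linarith [D.hε]) (by linarith [D.ha, D.sqrt_M₄_pos])

/-- `ε + M₃ x₀² = a x₀`: `x₀` is a root of `M₃ x² − a x + ε`. [folklore] -/
theorem root_identity : D.ε + D.M₃ * D.x₀ ^ 2 = D.a * D.x₀ := by
  set r := Real.sqrt D.M₄ with hr
  have hr2 : r ^ 2 = D.a ^ 2 - 4 * D.M₃ * D.ε := D.sq_sqrt_M₄
  have hpos : 0 < D.a + r := by linarith [D.ha, D.sqrt_M₄_pos]
  unfold x₀
  rw [← hr]
  field_simp
  linear_combination D.ε * hr2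

/-- The self-map lemma of the Schauder scheme (LEMMA-D.md §5, HWY-PROFILE-AUDIT step 7): an a-priori bound
`a s² + b t² ≤ (ε + M₃ x₀²) s` forces `s ≤ x₀` and `b t² ≤ a x₀² / 4`. [folklore] -/
theorem selfMap {s t : ℝ}
    (h : D.a * s ^ 2 + D.b * t ^ 2 ≤ (D.ε + D.M₃ * D.x₀ ^ 2) * s) :
    s ≤ D.x₀ ∧ D.b * t ^ 2 ≤ D.a * D.x₀ ^ 2 / 4 := by
  rw [D.root_identity] at h
  have hbt : 0 ≤ D.b * t ^ 2 := mul_nonneg D.hb.le (sq_nonneg t)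
  have hs_le : s ≤ D.x₀ := by
    by_contra hcon
    have hcon : D.x₀ < s := lt_of_not_ge hcon
    have h1 : D.a * s ^ 2 ≤ D.a * D.x₀ * s := by linarith
    have h2 : D.a * s * (s - D.x₀) ≤ 0 := by nlinarith
    have h3 : 0 < D.a * s := mul_pos D.ha (by linarith [D.x₀_nonneg])
    nlinarith
  refine ⟨hs_le, ?_⟩
  have h4 : D.b * t ^ 2 ≤ D.a * (s * (D.x₀ - s)) := by nlinarith
  have h5 : s * (D.x₀ - s) ≤ D.x₀ ^ 2 / 4 := by nlinarith [sq_nonneg (D.x₀ - 2 * s)]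
  calc D.b * t ^ 2 ≤ D.a * (s * (D.x₀ - s)) := h4
    _ ≤ D.a * (D.x₀ ^ 2 / 4) := by exact mul_le_mul_of_nonneg_left h5 D.ha.le
    _ = D.a * D.x₀ ^ 2 / 4 := by ring

/-- The gradient bound in the usual form `t ≤ √(a/b) · x₀ / 2`. [folklore] -/
theorem grad_le {s t : ℝ} (ht : 0 ≤ t)
    (h : D.a * s ^ 2 + D.b * t ^ 2 ≤ (D.ε + D.M₃ * D.x₀ ^ 2) * s) :
    t ≤ Real.sqrt (D.a / D.b) * D.x₀ / 2 := by
  have h2 := (D.selfMap h).2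
  have hx := D.x₀_nonneg
  have key : t ^ 2 ≤ (Real.sqrt (D.a / D.b) * D.x₀ / 2) ^ 2 := by
    have hsq : (Real.sqrt (D.a / D.b)) ^ 2 = D.a / D.b :=
      Real.sq_sqrt (div_nonneg D.ha.le D.hb.le)
    have : (Real.sqrt (D.a / D.b) * D.x₀ / 2) ^ 2 = D.a / D.b * D.x₀ ^ 2 / 4 := by
      rw [div_pow, mul_pow, hsq]; ring
    rw [this]
    have hb := D.hb
    rw [div_mul_eq_mul_div, div_div, le_div_iff₀ (by positivity)]
    nlinarith
  exact (pow_le_pow_iff_left₀ ht (by positivity) two_ne_zero).mp key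

/-! ## The tolerance-to-coercivity step (LEMMA-E.md Corollary E.3′; HWY25 (eq:TU lin est) re-derived, not cited)

On a space where the coercive part satisfies `q₁ f ≥ g f + (¼ − η₁) n f` (`g` = squared gradient norm, `n` = squared
norm) and the finite-rank defect satisfies `|q₂ f| ≤ M₁ g f + M₂ n f`, the corrected form is bounded below by
`(¼ − η₁ − M₂) n f + (1 − M₁) g f`. Purely real (linear) arithmetic — no sign condition on `g`, `n` is even needed; the domain caveat of LEMMA-E §5 (ii) — the inequality is
one of quadratic forms on `H¹_{0,σ}(B_R)`, not of the operator pairing on all of `H¹_σ(ℝ³)` — is the caller's. -/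

/-- E.3′ as a pointwise inequality of real quadratic forms: `q₁ + q₂ ≥ (¼ − η₁ − M₂) n + (1 − M₁) g`. [folklore] -/
theorem coercive_of_split {X : Type*} (q₁ q₂ g n : X → ℝ) (η₁ M₁ M₂ : ℝ)
    (h₁ : ∀ f, g f + (1 / 4 - η₁) * n f ≤ q₁ f)
    (h₂ : ∀ f, |q₂ f| ≤ M₁ * g f + M₂ * n f) (f : X) :
    (1 / 4 - η₁ - M₂) * n f + (1 - M₁) * g f ≤ q₁ f + q₂ f := by
  have := h₁ f
  have h2 := (abs_le.mp (h₂ f)).1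
  linarith

/-- The closing data built from the tolerances `(η₁, M₁, M₂)` of LEMMA-E: `a = ¼ − η₁ − M₂`, `b = 1 − M₁`, under
`η₁ + M₂ < ¼`, `M₁ < 1` and `4 M₃ ε < a²`. [folklore] -/
noncomputable def ofTolerances (η₁ M₁ M₂ ε M₃ : ℝ) (ha : η₁ + M₂ < 1 / 4) (hb : M₁ < 1) (hε : 0 ≤ ε) (hM₃ : 0 ≤ M₃)
    (closing : 4 * M₃ * ε < (1 / 4 - η₁ - M₂) ^ 2) : SchauderClosingData where
  a := 1 / 4 - η₁ - M₂
  b := 1 - M₁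
  ε := ε
  M₃ := M₃
  ha := by linarith
  hb := by linarith
  hε := hε
  hM₃ := hM₃
  closing := closing

/-- `a = ¼ − η₁ − M₂` for `ofTolerances`. [folklore] -/
@[simp] theorem ofTolerances_a (η₁ M₁ M₂ ε M₃ : ℝ) (ha hb hε hM₃ closing) :
    (ofTolerances η₁ M₁ M₂ ε M₃ ha hb hε hM₃ closing).a = 1 / 4 - η₁ - M₂ := rfl

/-- `b = 1 − M₁` for `ofTolerances`. [folklore] -/
@[simp] theorem ofTolerances_b (η₁ M₁ M₂ ε M₃ : ℝ) (ha hb hε hM₃ closing) :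
    (ofTolerances η₁ M₁ M₂ ε M₃ ha hb hε hM₃ closing).b = 1 - M₁ := rfl

/-- E.3′ feeding the self-map lemma: with `D = ofTolerances …`, a form split `q₁ + q₂` satisfying the two bounds
gives the coercivity `D.a · n f + D.b · g f ≤ q₁ f + q₂ f` that the a-priori bound of `selfMap` needs. [folklore] -/
theorem ofTolerances_coercive {X : Type*} (q₁ q₂ g n : X → ℝ) (η₁ M₁ M₂ ε M₃ : ℝ)
    (ha hb hε hM₃ closing)
    (h₁ : ∀ f, g f + (1 / 4 - η₁) * n f ≤ q₁ f)
    (h₂ : ∀ f, |q₂ f| ≤ M₁ * g f + M₂ * n f) (f : X) :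
    (ofTolerances η₁ M₁ M₂ ε M₃ ha hb hε hM₃ closing).a * n f
      + (ofTolerances η₁ M₁ M₂ ε M₃ ha hb hε hM₃ closing).b * g f ≤ q₁ f + q₂ f := by
  simpa using coercive_of_split q₁ q₂ g n η₁ M₁ M₂ h₁ h₂ f

end SchauderClosingData

end Literature.Analysis.FluidPDE.GuillodSverak2023
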